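import Mathlib.Analysis.SpecialFunctions.Complex.Circle
import HarnessLib

/-!
# The fold of two flows covering the coordinate translations of a disc, and the induced isotopy covering the
# ROTATION of the disc, with trivial holonomy

General topology of flows; theorems only (no definition, no named fact). This is the Bröcker–Jänich fold (proof of
(8.12): "`φ(u, y) = Φ¹_{u₁} ∘ ⋯ ∘ Φⁿ_{uₙ}(y)` […] `f ∘ φ(u, y) = u`") over a DISC of the plane `ℂ ≅ ℝ²`, written for
flows which cover the translations only CONDITIONALLY — as long as the translated base point stays in the disc and
the moving point starts in a region `A` of the total space (the situation of the tree's
`Geometry/Manifold/TranslationFlowLocal.apply_integralCurve_eq_add_smul_of_segment`: lifts cut off away from the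
region of interest, e.g. inside a small Milnor ball) — followed by the construction that the programme "localisation of
the nodal meridian monodromy" (crux K1 of `Summits/HodgeConjecture/HodgeConjecture/Theses/CyclicUnitaryPowers.lean`)
needs from it: an isotopy of the region `A` COVERING THE ROTATION `c ↦ e^{iθ}c` of the base disc whose time-`2π` map
is the IDENTITY (Arnold–Gusein-Zade–Varchenko II §1.1: off the Milnor ball the family over the disc is trivial, so the
monodromy can be taken to be the identity there).

Data: a space `M`, a continuous `p : M → ℂ`, continuous flows `θ₁, θ₂ : ℝ × M → M` (`θ(0, x) = x`,
`θ(t, θ(s, x)) = θ(t + s, x)`), a set `A ⊆ M` and a radius `δ`, such that for `x ∈ A` and every time `t` with the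
whole segment `p x + [0, t]·e_j` in the open disc `‖c‖ < δ` (`e₁ = 1`, `e₂ = i`), the flow line `θ_j(s, x)`,
`s ∈ [0, t]`, stays in `A` and covers the translation: `p (θ_j(s, x)) = p x + s·e_j` (hypotheses `h₁`, `h₂`).

* `fold_mem_and_apply_fold` / `unfold_mem_and_apply_unfold` / `unfold_fold` / `fold_unfold` — with
  `T c y = θ₂(Im c, θ₁(Re c, y))` and `S c q = θ₁(−Re c, θ₂(−Im c, q))`: for `p y = 0`, `y ∈ A`, `‖c‖ < δ`,
  `T c y ∈ A` and `p (T c y) = c` (the L-shaped path `0 → Re c → c` stays in the disc); symmetrically for `S`; and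
  `S c`, `T c` are mutually inverse (flow algebra);
* **`exists_rotationIsotopy_of_folds`** — the map `g(θ, q) = T(e^{iθ} p q, S(p q, q))` is continuous on `ℝ × M`,
  satisfies `g(0, q) = q` and **`g(2π, q) = q`** for all `q`, and for `q ∈ A` over the disc: `g(θ, q) ∈ A`,
  `p (g(θ, q)) = e^{iθ} · p q`, `g(θ + θ', q) = g(θ, g(θ', q))`.

Applied with `A ∩ B` for any `B` equally invariant (a sphere `{ρ = s}` of a shell, the complement of a ball), the
same statement records that `g` preserves `B`.

## References

* [BrockerJanichIDT1982] Th. Bröcker, K. Jänich, Introduction to Differential Topology, CUP 1982, (8.12) and its proof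
  (the fold `φ(u, y)` of the flows of the lifted basic fields).
* [ArnoldGuseinzadeVarchenko2012] V. I. Arnold, S. M. Gusein-Zade, A. N. Varchenko, Singularities of Differentiable Maps,
  Vol. 2, Part I §1.1 (held text p0013, p0025: the monodromy is the identity off the ball).
-/

noncomputable section

open Set Function Complex
open scoped Real

namespace Literature.Geometry.Manifold

section Fold

variable {M : Type*} {p : M → ℂ} {θ₁ θ₂ : ℝ × M → M} {A : Set M} {δ : ℝ}

/-! ### Segments of the L-shaped path stay in the disc -/

/-- `s ∈ [0, a]` (unordered) has `|s| ≤ |a|`. [folklore] -/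
private theorem abs_le_abs_of_mem_uIcc {s a : ℝ} (hs : s ∈ uIcc 0 a) : |s| ≤ |a| := by
  rcases mem_uIcc.1 hs with ⟨h0, h1⟩ | ⟨h0, h1⟩
  · rw [abs_of_nonneg h0, abs_of_nonneg (h0.trans h1)]; exact h1
  · rw [abs_of_nonpos h1, abs_of_nonpos (h0.trans h1)]; linarith

/-- `‖x + y i‖ ≤ ‖x' + y' i‖` when `|x| ≤ |x'|` and `|y| ≤ |y'|`. [folklore] -/
private theorem norm_mk_le {x y x' y' : ℝ} (hx : |x| ≤ |x'|) (hy : |y| ≤ |y'|) :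
    ‖(x : ℂ) + y * I‖ ≤ ‖(x' : ℂ) + y' * I‖ := by
  rw [Complex.norm_add_mul_I, Complex.norm_add_mul_I]
  exact Real.sqrt_le_sqrt (by nlinarith [sq_abs x, sq_abs x', sq_abs y, sq_abs y', abs_nonneg x, abs_nonneg y])

/-- Horizontal leg from a real base point `x`: `‖(x + s) + y·i‖ ≤ ‖c‖` hmm — stated as needed below: for the point
`x + y i` with `|x + s| ≤ |X|`, `|y| ≤ |Y|` the modulus is at most that of `X + Y i`. [folklore] -/
private theorem norm_lt_of_legs {x y X Y : ℝ} (hx : |x| ≤ |X|) (hy : |y| ≤ |Y|) {δ : ℝ} (hc : ‖(X : ℂ) + Y * I‖ < δ) :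
    ‖(x : ℂ) + y * I‖ < δ :=
  (norm_mk_le hx hy).trans_lt hc

/-- `c = Re c + Im c · i`. [folklore] -/
private theorem re_add_im' (c : ℂ) : ((c.re : ℂ) + c.im * I) = c := Complex.re_add_im c

/-! ### The fold and the unfold -/

/-- **The fold `T c y = θ₂(Im c, θ₁(Re c, y))` carries the fibre over `0` (inside `A`) into `A`, onto the fibre over
`c`**, for `‖c‖ < δ`: the L-shaped path `0 → Re c → c` stays in the disc. [cite: BrockerJanichIDT1982, (8.12) (proof, the fold)] -/
theorem fold_mem_and_apply_fold
    (h₁ : ∀ x ∈ A, ∀ t : ℝ, (∀ s ∈ uIcc 0 t, ‖p x + s‖ < δ) →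
      ∀ s ∈ uIcc 0 t, θ₁ (s, x) ∈ A ∧ p (θ₁ (s, x)) = p x + s)
    (h₂ : ∀ x ∈ A, ∀ t : ℝ, (∀ s ∈ uIcc 0 t, ‖p x + s * I‖ < δ) →
      ∀ s ∈ uIcc 0 t, θ₂ (s, x) ∈ A ∧ p (θ₂ (s, x)) = p x + s * I)
    {y : M} (hy : y ∈ A) (hpy : p y = 0) {c : ℂ} (hc : ‖c‖ < δ) :
    θ₂ (c.im, θ₁ (c.re, y)) ∈ A ∧ p (θ₂ (c.im, θ₁ (c.re, y))) = c := by
  have hc' : ‖(c.re : ℂ) + c.im * I‖ < δ := by rw [re_add_im']; exact hc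
  -- horizontal leg
  have hleg₁ : ∀ s ∈ uIcc 0 c.re, ‖p y + s‖ < δ := by
    intro s hs
    rw [hpy, zero_add]
    have h := norm_lt_of_legs (abs_le_abs_of_mem_uIcc hs) (y := 0) (Y := c.im) (by simp) hc'
    simpa using h
  obtain ⟨hy₁, hpy₁⟩ := h₁ y hy c.re hleg₁ c.re right_mem_uIcc
  rw [hpy, zero_add] at hpy₁
  -- vertical leg
  have hleg₂ : ∀ s ∈ uIcc 0 c.im, ‖p (θ₁ (c.re, y)) + s * I‖ < δ := by
    intro s hs
    rw [hpy₁]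
    exact norm_lt_of_legs le_rfl (abs_le_abs_of_mem_uIcc hs) hc'
  obtain ⟨hy₂, hpy₂⟩ := h₂ _ hy₁ c.im hleg₂ c.im right_mem_uIcc
  refine ⟨hy₂, ?_⟩
  rw [hpy₂, hpy₁, re_add_im']

/-- **The unfold `S c q = θ₁(−Re c, θ₂(−Im c, q))` carries the fibre over `c` (inside `A`) into `A`, onto the fibre
over `0`**, for `‖c‖ < δ`. [cite: BrockerJanichIDT1982, (8.12) (proof, the fold)] -/
theorem unfold_mem_and_apply_unfold
    (h₁ : ∀ x ∈ A, ∀ t : ℝ, (∀ s ∈ uIcc 0 t, ‖p x + s‖ < δ) →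
      ∀ s ∈ uIcc 0 t, θ₁ (s, x) ∈ A ∧ p (θ₁ (s, x)) = p x + s)
    (h₂ : ∀ x ∈ A, ∀ t : ℝ, (∀ s ∈ uIcc 0 t, ‖p x + s * I‖ < δ) →
      ∀ s ∈ uIcc 0 t, θ₂ (s, x) ∈ A ∧ p (θ₂ (s, x)) = p x + s * I)
    {q : M} (hq : q ∈ A) {c : ℂ} (hpq : p q = c) (hc : ‖c‖ < δ) :
    θ₁ (-c.re, θ₂ (-c.im, q)) ∈ A ∧ p (θ₁ (-c.re, θ₂ (-c.im, q))) = 0 := by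
  have hc' : ‖(c.re : ℂ) + c.im * I‖ < δ := by rw [re_add_im']; exact hc
  -- vertical leg down
  have hleg₂ : ∀ s ∈ uIcc 0 (-c.im), ‖p q + s * I‖ < δ := by
    intro s hs
    rw [hpq]
    have h : ‖(c.re : ℂ) + (c.im + s : ℝ) * I‖ < δ := by
      refine norm_lt_of_legs le_rfl ?_ hc'
      rcases mem_uIcc.1 hs with ⟨h0, h1⟩ | ⟨h0, h1⟩
      · rw [abs_le]; constructor <;> [skip; skip] <;> cases abs_cases c.im <;> linarith
      · rw [abs_le]; constructor <;> [skip; skip] <;> cases abs_cases c.im <;> linarith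
    have heq : (c : ℂ) + s * I = (c.re : ℂ) + (c.im + s : ℝ) * I := by
      apply Complex.ext <;> simp
    rw [heq]; exact h
  obtain ⟨hq₁, hpq₁⟩ := h₂ q hq (-c.im) hleg₂ (-c.im) right_mem_uIcc
  have hpq₁' : p (θ₂ (-c.im, q)) = c.re := by
    rw [hpq₁, hpq]
    apply Complex.ext <;> simp
  -- horizontal leg back
  have hleg₁ : ∀ s ∈ uIcc 0 (-c.re), ‖p (θ₂ (-c.im, q)) + s‖ < δ := by
    intro s hs
    rw [hpq₁']
    have h : ‖((c.re + s : ℝ) : ℂ) + (0 : ℝ) * I‖ < δ := by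
      refine norm_lt_of_legs ?_ (by simp) hc'
      rcases mem_uIcc.1 hs with ⟨h0, h1⟩ | ⟨h0, h1⟩
      · rw [abs_le]; constructor <;> [skip; skip] <;> cases abs_cases c.re <;> linarith
      · rw [abs_le]; constructor <;> [skip; skip] <;> cases abs_cases c.re <;> linarith
    simpa using h
  obtain ⟨hq₂, hpq₂⟩ := h₁ _ hq₁ (-c.re) hleg₁ (-c.re) right_mem_uIcc
  refine ⟨hq₂, ?_⟩
  rw [hpq₂, hpq₁']
  push_cast
  ring

/-- **Unfold after fold is the identity** (flow algebra: `θ₂(−b) θ₂(b) = id`, `θ₁(−a) θ₁(a) = id`).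
[cite: BrockerJanichIDT1982, (8.12) (proof, the fold)] -/
theorem unfold_fold (h0₁ : ∀ x, θ₁ (0, x) = x) (hadd₁ : ∀ t s x, θ₁ (t, θ₁ (s, x)) = θ₁ (t + s, x))
    (h0₂ : ∀ x, θ₂ (0, x) = x) (hadd₂ : ∀ t s x, θ₂ (t, θ₂ (s, x)) = θ₂ (t + s, x)) (a b : ℝ) (y : M) :
    θ₁ (-a, θ₂ (-b, θ₂ (b, θ₁ (a, y)))) = y := by
  rw [hadd₂, neg_add_cancel, h0₂, hadd₁, neg_add_cancel, h0₁]

/-- **Fold after unfold is the identity.** [cite: BrockerJanichIDT1982, (8.12) (proof, the fold)] -/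
theorem fold_unfold (h0₁ : ∀ x, θ₁ (0, x) = x) (hadd₁ : ∀ t s x, θ₁ (t, θ₁ (s, x)) = θ₁ (t + s, x))
    (h0₂ : ∀ x, θ₂ (0, x) = x) (hadd₂ : ∀ t s x, θ₂ (t, θ₂ (s, x)) = θ₂ (t + s, x)) (a b : ℝ) (q : M) :
    θ₂ (b, θ₁ (a, θ₁ (-a, θ₂ (-b, q)))) = q := by
  rw [hadd₁, add_neg_cancel, h0₁, hadd₂, add_neg_cancel, h0₂]

/-! ### The isotopy covering the rotation of the disc -/

/-- **An isotopy covering the rotation of the base disc, with trivial holonomy.** With the conditional translation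
flows `θ₁`, `θ₂` as above there is a continuous `g : ℝ × M → M` — `g(θ, q) = T(e^{iθ}·p q, S(p q, q))`, unfold to the
central fibre and fold back over the rotated point — such that `g(0, q) = q` and `g(2π, q) = q` for every `q`, and for
`q ∈ A` over the disc `‖p q‖ < δ`: `g(θ, q) ∈ A`, `p (g(θ, q)) = e^{iθ} · p q`, and the flow law
`g(θ + θ', q) = g(θ, g(θ', q))`. So `q ↦ g(θ, q)` carries `A ∩ p⁻¹(c)` bijectively onto `A ∩ p⁻¹(e^{iθ}c)`
(inverse `g(−θ, ·)`), and after a full turn every point is back where it started: over the disc the family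
restricted to `A` has TRIVIAL monodromy (AGZV II §1.1: the monodromy "is the identity near the boundary of the ball",
indeed everywhere off it). [cite: ArnoldGuseinzadeVarchenko2012, Part I §1.1 (held text p0013, p0025)]
[cite: BrockerJanichIDT1982, (8.12) (proof, the fold)] -/
theorem exists_rotationIsotopy_of_folds [TopologicalSpace M] (hp : Continuous p)
    (hθ₁ : Continuous θ₁) (h0₁ : ∀ x, θ₁ (0, x) = x) (hadd₁ : ∀ t s x, θ₁ (t, θ₁ (s, x)) = θ₁ (t + s, x))
    (hθ₂ : Continuous θ₂) (h0₂ : ∀ x, θ₂ (0, x) = x) (hadd₂ : ∀ t s x, θ₂ (t, θ₂ (s, x)) = θ₂ (t + s, x))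
    (h₁ : ∀ x ∈ A, ∀ t : ℝ, (∀ s ∈ uIcc 0 t, ‖p x + s‖ < δ) →
      ∀ s ∈ uIcc 0 t, θ₁ (s, x) ∈ A ∧ p (θ₁ (s, x)) = p x + s)
    (h₂ : ∀ x ∈ A, ∀ t : ℝ, (∀ s ∈ uIcc 0 t, ‖p x + s * I‖ < δ) →
      ∀ s ∈ uIcc 0 t, θ₂ (s, x) ∈ A ∧ p (θ₂ (s, x)) = p x + s * I) :
    ∃ g : ℝ × M → M, Continuous g ∧ (∀ q, g (0, q) = q) ∧ (∀ q, g (2 * π, q) = q) ∧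
      (∀ θ, ∀ q ∈ A, ‖p q‖ < δ → g (θ, q) ∈ A ∧ p (g (θ, q)) = Complex.exp (θ * I) * p q) ∧
      (∀ θ θ', ∀ q ∈ A, ‖p q‖ < δ → g (θ + θ', q) = g (θ, g (θ', q))) := by
  -- `T c y` and `S c q` written out
  let T : ℂ → M → M := fun c y => θ₂ (c.im, θ₁ (c.re, y))
  let S : ℂ → M → M := fun c q => θ₁ (-c.re, θ₂ (-c.im, q))
  let rot : ℝ → ℂ → ℂ := fun θ c => Complex.exp (θ * I) * c
  have hrot_norm : ∀ θ c, ‖rot θ c‖ = ‖c‖ := fun θ c => by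
    simp only [rot, norm_mul, Complex.norm_exp_ofReal_mul_I, one_mul]
  have hrot_zero : ∀ c, rot 0 c = c := fun c => by simp [rot]
  have hrot_add : ∀ θ θ' c, rot (θ + θ') c = rot θ (rot θ' c) := fun θ θ' c => by
    simp only [rot, Complex.ofReal_add, add_mul, Complex.exp_add]; ring
  have hrot_two_pi : ∀ c, rot (2 * π) c = c := fun c => by
    simp only [rot]
    rw [show ((2 * π : ℝ) : ℂ) * I = 2 * π * I by push_cast; ring, Complex.exp_two_pi_mul_I, one_mul]
  refine ⟨fun θq => T (rot θq.1 (p θq.2)) (S (p θq.2) θq.2), ?_, fun q => ?_, fun q => ?_, fun θ q hq hpq => ?_,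
    fun θ θ' q hq hpq => ?_⟩
  · -- continuity
    have hre : Continuous fun θq : ℝ × M => (rot θq.1 (p θq.2)).re :=
      Complex.continuous_re.comp (by
        simp only [rot]
        exact ((Complex.continuous_exp.comp ((Complex.continuous_ofReal.comp continuous_fst).mul
          continuous_const)).mul (hp.comp continuous_snd)))
    have him : Continuous fun θq : ℝ × M => (rot θq.1 (p θq.2)).im :=
      Complex.continuous_im.comp (by
        simp only [rot]
        exact ((Complex.continuous_exp.comp ((Complex.continuous_ofReal.comp continuous_fst).mul
          continuous_const)).mul (hp.comp continuous_snd)))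
    have hS : Continuous fun θq : ℝ × M => S (p θq.2) θq.2 := by
      simp only [S]
      exact hθ₁.comp ((Complex.continuous_re.comp (hp.comp continuous_snd)).neg.prodMk
        (hθ₂.comp ((Complex.continuous_im.comp (hp.comp continuous_snd)).neg.prodMk continuous_snd)))
    simp only [T]
    exact hθ₂.comp (him.prodMk (hθ₁.comp (hre.prodMk hS)))
  · -- `g 0 = id`
    show T (rot 0 (p q)) (S (p q) q) = q
    rw [hrot_zero]
    exact fold_unfold h0₁ hadd₁ h0₂ hadd₂ _ _ q
  · -- `g 2π = id`
    show T (rot (2 * π) (p q)) (S (p q) q) = q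
    rw [hrot_two_pi]
    exact fold_unfold h0₁ hadd₁ h0₂ hadd₂ _ _ q
  · -- over the disc: stays in `A`, covers the rotation
    show T (rot θ (p q)) (S (p q) q) ∈ A ∧ p (T (rot θ (p q)) (S (p q) q)) = rot θ (p q)
    obtain ⟨hS₁, hS₂⟩ := unfold_mem_and_apply_unfold h₁ h₂ hq rfl hpq
    exact fold_mem_and_apply_fold h₁ h₂ hS₁ hS₂ (by rw [hrot_norm]; exact hpq)
  · -- flow law
    show T (rot (θ + θ') (p q)) (S (p q) q) =
      T (rot θ (p (T (rot θ' (p q)) (S (p q) q)))) (S (p (T (rot θ' (p q)) (S (p q) q))) (T (rot θ' (p q)) (S (p q) q)))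
    obtain ⟨hS₁, hS₂⟩ := unfold_mem_and_apply_unfold h₁ h₂ hq rfl hpq
    obtain ⟨-, hT₂⟩ := fold_mem_and_apply_fold h₁ h₂ hS₁ hS₂ (c := rot θ' (p q)) (by rw [hrot_norm]; exact hpq)
    rw [hT₂]
    show _ = T (rot θ (rot θ' (p q))) (S (rot θ' (p q)) (T (rot θ' (p q)) (S (p q) q)))
    rw [← hrot_add]
    congr 1
    exact (unfold_fold h0₁ hadd₁ h0₂ hadd₂ _ _ _).symm

end Fold

end Literature.Geometry.Manifold

end
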